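import Literature.Barriers.RiemannHypothesis.MollifierLimitationsSelberg
import Literature.Barriers.RiemannHypothesis.MollifierLimitationsPropAProofs
import Literature.Barriers.RiemannHypothesis.MollifierLimitationsPropB
import Literature.Barriers.RiemannHypothesis.MollifierLimitationsPropBQuadFormProofs
import Literature.Barriers.RiemannHypothesis.MollifierLimitationsPropBAsymptoticProofs
import Literature.Barriers.RiemannHypothesis.MollifierLimitationsSmallTheta
import HarnessLib

/-!
# Radziwiłł 2012, Theorem 1: the assembled deduction and its current trust base

`Literature/Barriers/RiemannHypothesis/MollifierLimitations.lean` vendors **Theorem 1** of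
M. Radziwiłł, *Limitations to mollifying `ζ(s)`* (arXiv:1207.6583) as the named fact
`Radziwill2012_thm1` (`𝓘(M_θ) ≥ c/θ` for an absolute `c > 0`, every `θ > 0`, all large `T` and
every admissible mollifier of length `T^θ`). The printed proof is a tree of deductions, each of
which is now a theorem of the tree:

* §4: Theorem 1 ⇐ Proposition A + Lemma 5 + Proposition B
  (`Radziwill2012_thm1_of_inputs`, `MollifierLimitationsProofs.lean`);
* §4: Lemma 5 ⇐ Selberg's lemma (`Radziwill2012_lemma5_of_selbergLemma`,
  `MollifierLimitationsSelberg.lean`; also `Radziwill2012_lemma5_of_measure`,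
  `MollifierLimitationsLemma5.lean`);
* §3: Proposition A ⇐ Lemma 2 (`Radziwill2012_propA_of_lemma2`,
  `MollifierLimitationsPropAProofs.lean`, with Lemma 1, the large-sieve role of Lemmas 3–4 and
  the test function proved in `MollifierLimitationsPropAInputs.lean` /
  `MollifierLimitationsPropABump.lean`);
* Prop. B ⇐ its two printed relations (`Radziwill2012_propB_of_parts`,
  `MollifierLimitationsPropB.lean`), the second of which (Soundararajan's bound for the quadratic
  form, §7) is now the theorem `Radziwill2012_propB_quadForm_holds`
  (`MollifierLimitationsPropBQuadFormProofs.lean`), and the first of which (the asymptotic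
  `𝓘(M_θ) = 𝒬_T(a) − 1 + o(1)`, "due to Balasubramanian, Conrey and Heath-Brown", p. 3) is now the
  theorem `Radziwill2012_propB_asymptotic_of_BCH` (`MollifierLimitationsPropBAsymptoticProofs.lean`:
  the twisted first moment and the expansion `|1 − ζM|² = 1 − 2Re ζM + |ζM|²`, proved, on top of
  the Balasubramanian–Conrey–Heath-Brown twisted second moment); so Prop. B ⇐ the single named
  fact `BalasubramanianConreyHeathBrown1985_meanSquare` (`Radziwill2012_propB_of_BCH`).

Hence, along the printed route, Theorem 1 follows from the named facts (the composite term is the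
compile-checked `example` opening this file) —

1. `Radziwill2012_selbergLemma` — Selberg 1942 (positive proportion of critical zeros, in the
   dyadic measure form of [Radziwill2012, §4]);
2. `Radziwill2012_lemma2` — Bombieri–Friedlander 1995, Prop. 2 (smoothed approximation of `ζ`
   by a Dirichlet polynomial of length `T^{1+η}` with error `O_v(T^{-v})`);
3. `BalasubramanianConreyHeathBrown1985_meanSquare` — Balasubramanian–Conrey–Heath-Brown 1985
   (twisted second moment `T⁻¹∫_T^{2T}|ζA|² = 𝒬_T(a) + o(1)` for `θ < ½`), from which Prop. B's
   first relation follows (`Radziwill2012_propB_asymptotic_of_BCH`; the D-0026 review of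
   2026-08-15 retired the intermediate named fact `Radziwill2012_propB_asymptotic`);
4. `Radziwill2012_propB_quadForm` — Soundararajan's bound for the quadratic form
   [Radziwill2012, §7] — DISCHARGED (`Radziwill2012_propB_quadForm_holds`), so Theorem 1 along the
   printed route needs facts 1–3 only (`Radziwill2012_thm1_of_selberg_lemma2_BCH`,
   `MollifierLimitationsPropBAsymptoticProofs.lean`, now a deprecated pointer to
   `Radziwill2012_thm1_of_selberg_of_lemma2`, which makes fact 3 formally redundant);

and, **by a route that is not the printed one for `θ < ½`**, from facts 1–2 alone:
`MollifierLimitationsSmallTheta.lean` proves the range `0 < θ ≤ 1/(16e⁵)` of Theorem 1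
unconditionally (`SmallTheta.Radziwill2012_thm1_smallTheta`, duality with a sifted test
polynomial), which together with the floor `c/(1 + θ)` from Proposition A and Lemma 5
(`Radziwill2012_floor_of_propA_lemma5`) gives `Radziwill2012_thm1_of_propA_lemma5` and
`Radziwill2012_thm1_of_selberg_of_lemma2`. **Current trust base of `Radziwill2012_thm1`, and of
the barrier `MollifierLimitations` (whose Bettin–Gonek half is the theorem
`BettinGonek2017_thm1_holds`): facts 1 and 2** (`MollifierLimitations_of_selberg_of_lemma2`), both
deep theorems of the classical literature far from Mathlib (fact 1 is reduced in
`Literature/NumberTheory/LFunctions/SelbergMollifier.lean` to Titchmarsh's Lemmas 10.17, 10.18,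
10.20). Fact 3 stays vendored as the source of the sharp constant `c = 1` on `θ < ½`
(`Radziwill2012_propB_of_BCH`), but nothing in the cone of `MollifierLimitations` uses it.
No statement was weakened: every arrow lands literally in the vendored `Prop`s. (Later the same
day facts 1 and 2 were discharged as well — `Radziwill2012_selbergLemma_holds`,
`Radziwill2012_lemma2_holds` — and `MollifierLimitationsHolds.lean` proves `Radziwill2012_thm1` and
the barrier `MollifierLimitations` outright; this file keeps the record of the printed route. Its
former barrier-level composite `MollifierLimitations_of_facts` — facts 1–4 and
`BettinGonek2017_thm1` ⟹ `MollifierLimitations` — merely restated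
`MollifierLimitations_of_selberg_of_lemma2` under redundant hypotheses and was deleted,
dedup-00621; likewise its former named composite `Radziwill2012_thm1_of_facts` — facts 1–4 ⟹
`Radziwill2012_thm1` — was, as a statement, `Radziwill2012_thm1_of_selberg_of_lemma2` under the
two redundant hypotheses 3–4 and was deleted, dedup-00660: use
`Radziwill2012_thm1_of_selberg_of_lemma2`; only its proof term, the printed route, is kept below as
an anonymous `example`.)

## References

* [Radziwill2012] M. Radziwiłł, *Limitations to mollifying ζ(s)*, arXiv:1207.6583 (2012), §§3–4, 7.
-/

noncomputable section

namespace Literature.Barriers.RiemannHypothesis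

-- **Radziwiłł 2012, Theorem 1, along the printed route** [Radziwill2012, §§3–4, 7]: the composite
-- of the proved deductions of §§3–4 and of Proposition B, fed with the four named facts (Selberg's
-- lemma, Bombieri–Friedlander's smoothed approximation, the Balasubramanian–Conrey–Heath-Brown
-- twisted second moment, Soundararajan's quadratic-form bound). Kept anonymous: as a statement it
-- is `Radziwill2012_thm1_of_selberg_of_lemma2 hS h2` (dedup-00660); as a term it records, and
-- re-checks at every build, that the vendored arrows compose literally to `Radziwill2012_thm1`.
example (hS : Radziwill2012_selbergLemma) (h2 : Radziwill2012_lemma2)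
    (hB : BalasubramanianConreyHeathBrown1985_meanSquare) (hQ : Radziwill2012_propB_quadForm) :
    Radziwill2012_thm1 :=
  Radziwill2012_thm1_of_inputs (Radziwill2012_propA_of_lemma2 h2)
    (Radziwill2012_lemma5_of_selbergLemma hS)
    (Radziwill2012_propB_of_parts (Radziwill2012_propB_asymptotic_of_BCH hB) hQ)

/-- **The floor at every fixed length from Selberg's lemma and Bombieri–Friedlander alone**:
there is an absolute `c > 0` with `𝓘(M_θ) ≥ c/(1 + θ)` for every `θ > 0`, all large `T` and all
admissible coefficients (`Radziwill2012_floor_of_propA_lemma5` fed with the proved deductions;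
in the printed proof Proposition B, i.e. facts 3–4, enters only for the rate `1/θ` as `θ → 0`,
a rate now supplied unconditionally by `SmallTheta.Radziwill2012_thm1_smallTheta`).
[cite: Radziwill2012, §4] -/
theorem Radziwill2012_floor_of_selberg_of_lemma2 (hS : Radziwill2012_selbergLemma)
    (h2 : Radziwill2012_lemma2) :
    ∃ c : ℝ, 0 < c ∧ ∀ θ : ℝ, 0 < θ → ∀ C : ℝ → ℝ, ∃ T₀ : ℝ, ∀ T : ℝ, T₀ ≤ T →
      ∀ a : ℕ → ℂ, a 1 = 1 →
        (∀ ε : ℝ, 0 < ε → ∀ n : ℕ, 1 ≤ n → ‖a n‖ ≤ C ε * (n : ℝ) ^ ε) →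
          c / (1 + θ) ≤ mollificationDefect (dirichletMollifier a ⌊T ^ θ⌋₊) T :=
  Radziwill2012_floor_of_propA_lemma5 (Radziwill2012_propA_of_lemma2 h2)
    (Radziwill2012_lemma5_of_selbergLemma hS)

end Literature.Barriers.RiemannHypothesis
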